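import Summits.Langlands.Langlands.Theses.GaloisHullLift
import Summits.Langlands.Langlands.Theorems.RootDecomp1SemisimpleAvatarOfSplit
import Literature.NumberTheory.Automorphic.ReciprocityGLnRestrictionProofs
import Literature.NumberTheory.Automorphic.ChebotarevArtinRepHolds
import Literature.NumberTheory.GaloisRepresentations.CliffordTwistOfRestriction
import Literature.NumberTheory.GaloisRepresentations.FramedRepEquivConj
import Literature.NumberTheory.GaloisRepresentations.AbsGaloisOuterConj
import Literature.NumberTheory.GaloisRepresentations.RestrictFieldSemisimple
import Literature.NumberTheory.GaloisRepresentations.FramedRepTwist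
import Literature.NumberTheory.GaloisRepresentations.VerlagerungTransitive
import Literature.NumberTheory.GaloisRepresentations.PadicCharacterNthRoot
import Literature.RepresentationTheory.IrreducibleTwistTransport
import Literature.RepresentationTheory.Semisimple.IrreducibleOfCharpoly

/-!
# TatePhantomLiftPrelude — pieces (§0) and the framed-representation / relative-avatar lemmas (§1–§2) of the lens-4 g26 node `TatePhantomLift`
(census twin, part 1 of 2; split only to honour the 400-line Theorems lint).  See `TatePhantomLift.lean` (part 2) for the module documentation, the kernel and `closes`.

PRINT SOURCES of the pieces (kept HERE, in the module docstring, not in the piece docstrings — the pieces are node-local STATEMENTS of the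
lens-4 g26 node / the frozen child route `PerfectLayerClifford` v2, consumed only as hypotheses; none is asserted): TP — Tate's vanishing of
the Schur multiplier of the absolute Galois group of a number field (Serre, Modular forms of weight one and Galois representations, 1977,
Theorem 4), whence projective representations lift (B. Conrad, Lifting global representations with local properties, Proposition 5.3;
S. Patrikis, Variations on a theorem of Tate, arXiv 1207.6724, Theorem 1.0.16 and Proposition 1.0.18), plus Clifford theory (1937); W1 — Galois
avatars of algebraic Hecke characters (Weil 1956; Serre, Abelian l-adic representations, 1968); DIV — structure of units of local fields
(Serre, Local Fields, Chapter XIV, section 4); LAY — elementary Galois theory (Galois closure of the field cut out by a finite-order character).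
-/

set_option linter.dupNamespace false
set_option linter.unusedVariables false
set_option linter.style.longLine false

namespace Summit.Langlands.Langlands.Theorems.TatePhantomLift

open scoped BigOperators Topology Manifold Classical MeasureTheory ProbabilityTheory Matrix InnerProductSpace ComplexConjugate ContinuousMap
open Filter Set Function TopologicalSpace MeasureTheory
open Literature.NumberTheory.GaloisRepresentations Literature.NumberTheory.Automorphic
open IsDedekindDomain
open Summit.Langlands.Langlands.Theses
open Summit.Langlands.Langlands.Theses.GaloisHullLift
open scoped NumberField Polynomial

/-! ## §0 The pieces.  TARGET = EXT (`PerfectLayerClifford.PerfectLayerExtension`, g25 node-local crux r2, restated verbatim; sha12 330085e4f017) -/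

/-- **TARGET · EXT** (verbatim g25 `PerfectLayerClifford.PerfectLayerExtension`, sha12 `330085e4f017`): an irreducible semisimple relative
avatar across a layer without cyclic-prime sub-layers is the restriction of a semisimple `ρ₀` over `K` with the same relative avatar. -/
def PerfectLayerExtension : Prop :=
  ∀ (K : Type) [Field K] [NumberField K] (n : ℕ) (hcpt : Literature.NumberTheory.Automorphic.isCompact_glFiniteIntegralLevel n K), 0 < n → ∀ (π : Literature.NumberTheory.Automorphic.CuspidalAutomorphicRepData n K hcpt), π.1.IsLAlgebraic → ∀ (L : Type) [Field L] [NumberField L] [Algebra K L], IsGalois K L → Module.finrank K L ≠ 1 → (¬ ∃ F : IntermediateField K L, F ≠ ⊥ ∧ IsGalois K ↥F ∧ IsCyclic (↥F ≃ₐ[K] ↥F) ∧ (Module.finrank K ↥F).Prime) → ∀ (ℓ : ℕ) [Fact ℓ.Prime] (ι : PadicAlgCl ℓ ≃+* ℂ) (r : Literature.NumberTheory.GaloisRepresentations.FramedGaloisRep L (PadicAlgCl ℓ) n), r.toGaloisRep.IsSemisimple → r.IsIrreducible → (∀ᶠ w : IsDedekindDomain.HeightOneSpectrum (NumberField.RingOfIntegers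 L) in cofinite, ∀ (v : IsDedekindDomain.HeightOneSpectrum (NumberField.RingOfIntegers K)) (α : Multiset ℂ), w.asIdeal.under (NumberField.RingOfIntegers K) = v.asIdeal → π.1.HasSatakeParamAt v α → r.IsUnramifiedAt w ∧ r.HasFrobCharpolyAt w (Literature.NumberTheory.Automorphic.arithFrobPolyOfSatake ι w.residueCard 1 (α.map (fun a => a ^ w.asIdeal.inertiaDeg (NumberField.RingOfIntegers K))))) → ∃ ρ₀ : Literature.NumberTheory.GaloisRepresentations.FramedGaloisRep K (PadicAlgCl ℓ) n, ρ₀.toGaloisRep.IsSemisimple ∧ (∀ᶠ w : IsDedekindDomain.HeightOneSpectrum (NumberField.RingOfIntegers L) in cofinite, ∀ (v : IsDedekindDomain.HeightOneSpectrum (NumberField.RingOfIntegers K)) (α : Multiset ℂ), w.asIdeal.under (NumberField.RingOfIntegers K) = v.asIdeal → π.1.HasSatakeParamAt v α → (ρ₀.restrictField L).IsUnramifiedAt w ∧ (ρ₀.restrictField L).HasFrobCharpolyAt w (Literature.NumberTheory.Automorphic.arithFrobPolyOfSatake ι w.residueCard 1 (α.map (fun a => a ^ w.asIdeal.inertiaDeg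 (NumberField.RingOfIntegers K)))))

/-- **TP · support · PRINT · NOT S-implied · EXCESS** — Tate–Clifford twisted extension: an IRREDUCIBLE `r : Γ_L → GL_n(ℚ̄_ℓ)` whose
conjugates `r^τ (τ ∈ Γ_K)` are all equivalent to `r` is, after a twist by a continuous character `c` of `Γ_L`, the restriction of a
continuous `ρ₁ : Γ_K → GL_n(ℚ̄_ℓ)`.  (Tate's vanishing of the Schur multiplier of `Γ_K` ⟹ projective representations of `Γ_K` lift; Clifford:
the projectivisation of an invariant irreducible extends — print sources in the module docstring; the cyclic case is the tree's PROVED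
`exists_restrictField_eq_of_forall_outerConj`.)
Why it might fail: only continuity bookkeeping (the projective extension is continuous on the open subgroup `Γ_L`). -/
def TateTwistedExtension : Prop :=
  ∀ (K L : Type) [Field K] [NumberField K] [Field L] [NumberField L] [Algebra K L] [IsGalois K L] (ℓ : ℕ) [Fact ℓ.Prime] (n : ℕ) (r : Literature.NumberTheory.GaloisRepresentations.FramedGaloisRep L (PadicAlgCl ℓ) n), r.IsIrreducible → (∀ τ : Field.absoluteGaloisGroup K, ∃ P : GL (Fin n) (PadicAlgCl ℓ), Literature.NumberTheory.GaloisRepresentations.FramedRep.conj P (Literature.NumberTheory.GaloisRepresentations.FramedGaloisRep.outerConj τ r) = r) → ∃ (ρ₁ : Literature.NumberTheory.GaloisRepresentations.FramedGaloisRep K (PadicAlgCl ℓ) n) (c : Field.absoluteGaloisGroup L →ₜ* (PadicAlgCl ℓ)ˣ), ρ₁.restrictField L = Literature.NumberTheory.GaloisRepresentations.FramedRep.twist r c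

/-- **W1 · support · S-implied · EXT-implied · GL₁** — the determinant of the relative avatar descends: `det r = Ψ|Γ_L` for a continuous
character `Ψ` of `Γ_K` (the `ℓ`-adic avatar of the central character of `π`, an algebraic Hecke character — print sources in the module
docstring; EXT with `n = 1` content; `w1_of_ext`). Why it might fail: it does not modulo print (Hecke characters have Galois avatars); in-tree only
finite-order `GL₁` is available (census P1). -/
def LayerDeterminantDescent : Prop :=
  ∀ (K : Type) [Field K] [NumberField K] (n : ℕ) (hcpt : Literature.NumberTheory.Automorphic.isCompact_glFiniteIntegralLevel n K), 0 < n → ∀ (π : Literature.NumberTheory.Automorphic.CuspidalAutomorphicRepData n K hcpt), π.1.IsLAlgebraic → ∀ (L : Type) [Field L] [NumberField L] [Algebra K L], IsGalois K L → Module.finrank K L ≠ 1 → (¬ ∃ F : IntermediateField K L, F ≠ ⊥ ∧ IsGalois K ↥F ∧ IsCyclic (↥F ≃ₐ[K] ↥F) ∧ (Module.finrank K ↥F).Prime) → ∀ (ℓ : ℕ) [Fact ℓ.Prime] (ι : PadicAlgCl ℓ ≃+* ℂ) (r : Literature.NumberTheory.GaloisRepresentations.FramedGaloisRep L (PadicAlgCl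 ℓ) n), r.toGaloisRep.IsSemisimple → r.IsIrreducible → (∀ᶠ w : IsDedekindDomain.HeightOneSpectrum (NumberField.RingOfIntegers L) in cofinite, ∀ (v : IsDedekindDomain.HeightOneSpectrum (NumberField.RingOfIntegers K)) (α : Multiset ℂ), w.asIdeal.under (NumberField.RingOfIntegers K) = v.asIdeal → π.1.HasSatakeParamAt v α → r.IsUnramifiedAt w ∧ r.HasFrobCharpolyAt w (Literature.NumberTheory.Automorphic.arithFrobPolyOfSatake ι w.residueCard 1 (α.map (fun a => a ^ w.asIdeal.inertiaDeg (NumberField.RingOfIntegers K))))) → ∃ Ψ : Field.absoluteGaloisGroup K →ₜ* (PadicAlgCl ℓ)ˣ, ∀ σ : Field.absoluteGaloisGroup L, Ψ (Literature.NumberTheory.GaloisRepresentations.absGaloisRestrict K L σ) = Matrix.GeneralLinearGroup.det (r σ)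

/-- **DIV · support · elementary · NOT S-implied · EXCESS** — continuous `ℓ`-adic characters of `Γ_K` have `N`-th roots modulo characters
of finite order (`Ψ(Γ_K)` is a compact subgroup of `𝒪_Eˣ`; `U¹` is uniquely divisible by `N` prime to `ℓ` and divisible up to the
finite index `[U¹ : (U¹)^N]` in general).  Rung `div_rung` (`ℓ ≠ 2`, `ℓ ∤ N`) PROVED below from the tree. (units of local fields; print source in the module docstring). -/
def AdicRootModTorsion : Prop :=
  ∀ (K : Type) [Field K] [NumberField K] (ℓ : ℕ) [Fact ℓ.Prime] (Ψ : Field.absoluteGaloisGroup K →ₜ* (PadicAlgCl ℓ)ˣ) (N : ℕ), 0 < N → ∃ (ψ : Field.absoluteGaloisGroup K →ₜ* (PadicAlgCl ℓ)ˣ) (m : ℕ), 0 < m ∧ ∀ g : Field.absoluteGaloisGroup K, (ψ g ^ N * (Ψ g)⁻¹) ^ m = 1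

/-- **LAY · support · elementary Galois theory · NOT S-implied · EXCESS** — a finite-order continuous character `c` of `Γ_L` is trivial
on `Γ_{L'}` for some finite Galois `L'/K ⊇ L` with `Gal(L'/L)` abelian (`L'` = Galois closure over `K` of the field cut out by `c`;
`Gal(L'/L) ↪ ∏_τ c^τ(Γ_L)`). (pattern of the tree's `LanglandsTunnellMonomial` fixed-field construction). -/
def FiniteCharacterSplitting : Prop :=
  ∀ (K L : Type) [Field K] [NumberField K] [Field L] [NumberField L] [Algebra K L], IsGalois K L → ∀ (ℓ : ℕ) [Fact ℓ.Prime] (c : Field.absoluteGaloisGroup L →ₜ* (PadicAlgCl ℓ)ˣ), (∃ N : ℕ, 0 < N ∧ ∀ g : Field.absoluteGaloisGroup L, c g ^ N = 1) → ∃ (L' : Type) (_ : Field L') (_ : NumberField L') (_ : Algebra K L') (_ : Algebra L L') (_ : IsScalarTower K L L'), IsGalois K L' ∧ (∀ g h : L' ≃ₐ[L] L', g * h = h * g) ∧ ∀ σ : Field.absoluteGaloisGroup L', c (Literature.NumberTheory.GaloisRepresentations.absGaloisRestrict L L' σ) = 1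

/-- **RIGID · crux · g25 rank 3 RESTATED VERBATIM** (`PerfectLayerClifford.PerfectLayerRigidity`, sha12 `6f5d782b2b84`) — given the
irreducible relative avatar and SOME semisimple candidate `ρ₀` over `K` carrying it, a semisimple `ρ` over `K` is compatible with `π`
a.e.  Consumed here ONE FLOOR UP, on the enlarged layer `L'/K`. -/
def PerfectLayerRigidity : Prop :=
  ∀ (K : Type) [Field K] [NumberField K] (n : ℕ) (hcpt : Literature.NumberTheory.Automorphic.isCompact_glFiniteIntegralLevel n K), 0 < n → ∀ (π : Literature.NumberTheory.Automorphic.CuspidalAutomorphicRepData n K hcpt), π.1.IsLAlgebraic → ∀ (L : Type) [Field L] [NumberField L] [Algebra K L], IsGalois K L → Module.finrank K L ≠ 1 → (¬ ∃ F : IntermediateField K L, F ≠ ⊥ ∧ IsGalois K ↥F ∧ IsCyclic (↥F ≃ₐ[K] ↥F) ∧ (Module.finrank K ↥F).Prime) → ∀ (ℓ : ℕ) [Fact ℓ.Prime] (ι : PadicAlgCl ℓ ≃+* ℂ) (r : Literature.NumberTheory.GaloisRepresentations.FramedGaloisRep L (PadicAlgCl ℓ) n), r.toGaloisRep.IsSemisimple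 → r.IsIrreducible → (∃ ρ₀ : Literature.NumberTheory.GaloisRepresentations.FramedGaloisRep K (PadicAlgCl ℓ) n, ρ₀.toGaloisRep.IsSemisimple ∧ (∀ᶠ w : IsDedekindDomain.HeightOneSpectrum (NumberField.RingOfIntegers L) in cofinite, ∀ (v : IsDedekindDomain.HeightOneSpectrum (NumberField.RingOfIntegers K)) (α : Multiset ℂ), w.asIdeal.under (NumberField.RingOfIntegers K) = v.asIdeal → π.1.HasSatakeParamAt v α → (ρ₀.restrictField L).IsUnramifiedAt w ∧ (ρ₀.restrictField L).HasFrobCharpolyAt w (Literature.NumberTheory.Automorphic.arithFrobPolyOfSatake ι w.residueCard 1 (α.map (fun a => a ^ w.asIdeal.inertiaDeg (NumberField.RingOfIntegers K)))))) → (∀ᶠ w : IsDedekindDomain.HeightOneSpectrum (NumberField.RingOfIntegers L) in cofinite, ∀ (v : IsDedekindDomain.HeightOneSpectrum (NumberField.RingOfIntegers K)) (α : Multiset ℂ), w.asIdeal.under (NumberField.RingOfIntegers K) = v.asIdeal → π.1.HasSatakeParamAt v α → r.IsUnramifiedAt w ∧ r.HasFrobCharpolyAt w (Literature.NumberTheory.Automorphic.arithFrobPolyOfSatake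 ι w.residueCard 1 (α.map (fun a => a ^ w.asIdeal.inertiaDeg (NumberField.RingOfIntegers K))))) → ∃ ρ : Literature.NumberTheory.GaloisRepresentations.FramedGaloisRep K (PadicAlgCl ℓ) n, ρ.toGaloisRep.IsSemisimple ∧ ∀ᶠ v : IsDedekindDomain.HeightOneSpectrum (NumberField.RingOfIntegers K) in cofinite, SatakeFrobCompatibleAt ι π.1 ρ v

/-- **ELCR · DECLARED RESIDUAL · S-implied · EXT-implied** — enlarged-layer candidate descent, IMPRIMITIVE CELL: for a finite Galois
`L'/K ⊇ L` with `Gal(L'/L)` abelian and an IRREDUCIBLE `ρ₁` over `K` with `ρ₁|Γ_{L'}` conjugate to `r|Γ_{L'}` that is a GENUINE PHANTOM LIFT (no twist of `ρ₁`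
by a character of `Γ_K` restricts to a conjugate of `r` on `Γ_L` — else that twist extends `r` and EXT holds outright, kernel step 5½), in the cell «`L'/K` has a
cyclic sub-layer of prime degree OR `r|Γ_{L'}` is reducible», EXT's conclusion holds.  (Disjunct 1 = solvable peel from the top:
BCE 27863 / CPD 27860 / RIGID over the perfect core, induction on `[L':K]`; disjunct 2 = `r` induced from an intermediate layer: the
self-twisted branch RSELF 28226.)  Why it might fail: it is implied by EXT (`elcr_of_ext`), hence by S; open. -/
def ImprimitiveEnlargementDescent : Prop :=
  ∀ (K : Type) [Field K] [NumberField K] (n : ℕ) (hcpt : Literature.NumberTheory.Automorphic.isCompact_glFiniteIntegralLevel n K), 0 < n → ∀ (π : Literature.NumberTheory.Automorphic.CuspidalAutomorphicRepData n K hcpt), π.1.IsLAlgebraic → ∀ (L : Type) [Field L] [NumberField L] [Algebra K L], IsGalois K L → Module.finrank K L ≠ 1 → (¬ ∃ F : IntermediateField K L, F ≠ ⊥ ∧ IsGalois K ↥F ∧ IsCyclic (↥F ≃ₐ[K] ↥F) ∧ (Module.finrank K ↥F).Prime) → ∀ (ℓ : ℕ) [Fact ℓ.Prime] (ι : PadicAlgCl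 ℓ ≃+* ℂ) (r : Literature.NumberTheory.GaloisRepresentations.FramedGaloisRep L (PadicAlgCl ℓ) n), r.toGaloisRep.IsSemisimple → r.IsIrreducible → (∀ᶠ w : IsDedekindDomain.HeightOneSpectrum (NumberField.RingOfIntegers L) in cofinite, ∀ (v : IsDedekindDomain.HeightOneSpectrum (NumberField.RingOfIntegers K)) (α : Multiset ℂ), w.asIdeal.under (NumberField.RingOfIntegers K) = v.asIdeal → π.1.HasSatakeParamAt v α → r.IsUnramifiedAt w ∧ r.HasFrobCharpolyAt w (Literature.NumberTheory.Automorphic.arithFrobPolyOfSatake ι w.residueCard 1 (α.map (fun a => a ^ w.asIdeal.inertiaDeg (NumberField.RingOfIntegers K))))) → ∀ (L' : Type) [Field L'] [NumberField L'] [Algebra K L'] [Algebra L L'] [IsScalarTower K L L'], IsGalois K L' → (∀ g h : L' ≃ₐ[L] L', g * h = h * g) → ∀ ρ₁ : Literature.NumberTheory.GaloisRepresentations.FramedGaloisRep K (PadicAlgCl ℓ) n, ρ₁.IsIrreducible → (∃ P : GL (Fin n) (PadicAlgCl ℓ), ρ₁.restrictField L' = Literature.NumberTheory.GaloisRepresentations.FramedRep.conj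 P (r.restrictField L')) → (∀ (χ : Field.absoluteGaloisGroup K →ₜ* (PadicAlgCl ℓ)ˣ) (P : GL (Fin n) (PadicAlgCl ℓ)), Literature.NumberTheory.GaloisRepresentations.FramedGaloisRep.restrictField L (Literature.NumberTheory.GaloisRepresentations.FramedRep.twist ρ₁ χ) ≠ Literature.NumberTheory.GaloisRepresentations.FramedRep.conj P r) → ((∃ F : IntermediateField K L', F ≠ ⊥ ∧ IsGalois K ↥F ∧ IsCyclic (↥F ≃ₐ[K] ↥F) ∧ (Module.finrank K ↥F).Prime) ∨ ¬ (r.restrictField L').IsIrreducible) → ∃ ρ₀ : Literature.NumberTheory.GaloisRepresentations.FramedGaloisRep K (PadicAlgCl ℓ) n, ρ₀.toGaloisRep.IsSemisimple ∧ (∀ᶠ w : IsDedekindDomain.HeightOneSpectrum (NumberField.RingOfIntegers L) in cofinite, ∀ (v : IsDedekindDomain.HeightOneSpectrum (NumberField.RingOfIntegers K)) (α : Multiset ℂ), w.asIdeal.under (NumberField.RingOfIntegers K) = v.asIdeal → π.1.HasSatakeParamAt v α → (ρ₀.restrictField L).IsUnramifiedAt w ∧ (ρ₀.restrictField L).HasFrobCharpolyAt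 w (Literature.NumberTheory.Automorphic.arithFrobPolyOfSatake ι w.residueCard 1 (α.map (fun a => a ^ w.asIdeal.inertiaDeg (NumberField.RingOfIntegers K)))))

/-- g25 rank 4, restated verbatim (sha12 `3924d1b21172`) — used only in the flattened host corollary `closes_host`. -/
def FiniteTypePerfectDescent : Prop :=
  ∀ (K : Type) [Field K] [NumberField K] (n : ℕ) (hcpt : Literature.NumberTheory.Automorphic.isCompact_glFiniteIntegralLevel n K), 0 < n → ∀ (π : Literature.NumberTheory.Automorphic.CuspidalAutomorphicRepData n K hcpt), π.1.IsLAlgebraic → ∀ (L : Type) [Field L] [NumberField L] [Algebra K L], IsGalois K L → Module.finrank K L ≠ 1 → (¬ ∃ F : IntermediateField K L, F ≠ ⊥ ∧ IsGalois K ↥F ∧ IsCyclic (↥F ≃ₐ[K] ↥F) ∧ (Module.finrank K ↥F).Prime) → ∀ (ℓ : ℕ) [Fact ℓ.Prime] (ι : PadicAlgCl ℓ ≃+* ℂ) (r : Literature.NumberTheory.GaloisRepresentations.FramedGaloisRep L (PadicAlgCl ℓ) n), r.toGaloisRep.IsSemisimple → ¬ r.IsIrreducible → (∀ᶠ v : IsDedekindDomain.HeightOneSpectrum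 (NumberField.RingOfIntegers K) in cofinite, ∀ α : Multiset ℂ, π.1.HasSatakeParamAt v α → ∀ a ∈ α, ∀ b ∈ α, ∃ k : ℕ, 0 < k ∧ a ^ k = b ^ k) → (∀ᶠ w : IsDedekindDomain.HeightOneSpectrum (NumberField.RingOfIntegers L) in cofinite, ∀ (v : IsDedekindDomain.HeightOneSpectrum (NumberField.RingOfIntegers K)) (α : Multiset ℂ), w.asIdeal.under (NumberField.RingOfIntegers K) = v.asIdeal → π.1.HasSatakeParamAt v α → r.IsUnramifiedAt w ∧ r.HasFrobCharpolyAt w (Literature.NumberTheory.Automorphic.arithFrobPolyOfSatake ι w.residueCard 1 (α.map (fun a => a ^ w.asIdeal.inertiaDeg (NumberField.RingOfIntegers K))))) → ∃ ρ : Literature.NumberTheory.GaloisRepresentations.FramedGaloisRep K (PadicAlgCl ℓ) n, ρ.toGaloisRep.IsSemisimple ∧ ∀ᶠ v : IsDedekindDomain.HeightOneSpectrum (NumberField.RingOfIntegers K) in cofinite, SatakeFrobCompatibleAt ι π.1 ρ v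

/-- g25 rank 5, restated verbatim (sha12 `dc1b1d2efc14`) — used only in the flattened host corollary `closes_host`. -/
def ReduciblePerfectDescent : Prop :=
  ∀ (K : Type) [Field K] [NumberField K] (n : ℕ) (hcpt : Literature.NumberTheory.Automorphic.isCompact_glFiniteIntegralLevel n K), 0 < n → ∀ (π : Literature.NumberTheory.Automorphic.CuspidalAutomorphicRepData n K hcpt), π.1.IsLAlgebraic → ∀ (L : Type) [Field L] [NumberField L] [Algebra K L], IsGalois K L → Module.finrank K L ≠ 1 → (¬ ∃ F : IntermediateField K L, F ≠ ⊥ ∧ IsGalois K ↥F ∧ IsCyclic (↥F ≃ₐ[K] ↥F) ∧ (Module.finrank K ↥F).Prime) → ∀ (ℓ : ℕ) [Fact ℓ.Prime] (ι : PadicAlgCl ℓ ≃+* ℂ) (r : Literature.NumberTheory.GaloisRepresentations.FramedGaloisRep L (PadicAlgCl ℓ) n), r.toGaloisRep.IsSemisimple → ¬ r.IsIrreducible → (¬ (∀ᶠ v : IsDedekindDomain.HeightOneSpectrum (NumberField.RingOfIntegers K) in cofinite, ∀ α : Multiset ℂ, π.1.HasSatakeParamAt v α → ∀ a ∈ α,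 ∀ b ∈ α, ∃ k : ℕ, 0 < k ∧ a ^ k = b ^ k)) → (∀ᶠ w : IsDedekindDomain.HeightOneSpectrum (NumberField.RingOfIntegers L) in cofinite, ∀ (v : IsDedekindDomain.HeightOneSpectrum (NumberField.RingOfIntegers K)) (α : Multiset ℂ), w.asIdeal.under (NumberField.RingOfIntegers K) = v.asIdeal → π.1.HasSatakeParamAt v α → r.IsUnramifiedAt w ∧ r.HasFrobCharpolyAt w (Literature.NumberTheory.Automorphic.arithFrobPolyOfSatake ι w.residueCard 1 (α.map (fun a => a ^ w.asIdeal.inertiaDeg (NumberField.RingOfIntegers K))))) → ∃ ρ : Literature.NumberTheory.GaloisRepresentations.FramedGaloisRep K (PadicAlgCl ℓ) n, ρ.toGaloisRep.IsSemisimple ∧ ∀ᶠ v : IsDedekindDomain.HeightOneSpectrum (NumberField.RingOfIntegers K) in cofinite, SatakeFrobCompatibleAt ι π.1 ρ v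

/-! ## §1 Framed-representation algebra (restriction, twists, change of frame, towers; 0 sorry) -/
section Algebra

variable {K L : Type} [Field K] [NumberField K] [Field L] [NumberField L] [Algebra K L]
variable {ℓ : ℕ} [Fact ℓ.Prime] {n : ℕ}

omit [NumberField K] [NumberField L] in
/-- Restriction commutes with twisting. [folklore] -/
theorem restrictField_twist (ρ : FramedGaloisRep K (PadicAlgCl ℓ) n) (χ : Field.absoluteGaloisGroup K →ₜ* (PadicAlgCl ℓ)ˣ) :
    FramedGaloisRep.restrictField L (FramedRep.twist ρ χ) = FramedRep.twist (ρ.restrictField L) (χ.comp (absGaloisRestrict K L)) :=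
  ContinuousMonoidHom.ext fun _ => rfl

omit [NumberField K] [NumberField L] in
/-- Restriction commutes with a change of frame. [folklore] -/
theorem restrictField_conj (ρ : FramedGaloisRep K (PadicAlgCl ℓ) n) (P : GL (Fin n) (PadicAlgCl ℓ)) :
    FramedGaloisRep.restrictField L (FramedRep.conj P ρ) = FramedRep.conj P (ρ.restrictField L) :=
  ContinuousMonoidHom.ext fun _ => rfl

/-- Pointwise composition of continuous homomorphisms. [folklore] -/
theorem cmh_comp_apply {G H E : Type*} [Monoid G] [TopologicalSpace G] [Monoid H] [TopologicalSpace H] [Monoid E] [TopologicalSpace E]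
    (g : H →ₜ* E) (f : G →ₜ* H) (x : G) : g.comp f x = g (f x) := rfl

omit [NumberField K] in
/-- Two changes of frame compose. [folklore] -/
theorem conj_conj (ρ : FramedGaloisRep K (PadicAlgCl ℓ) n) (P Q : GL (Fin n) (PadicAlgCl ℓ)) :
    FramedRep.conj P (FramedRep.conj Q ρ) = FramedRep.conj (P * Q) ρ := by
  refine ContinuousMonoidHom.ext fun g => ?_
  simp only [FramedRep.conj_apply, mul_inv_rev]
  group

omit [NumberField K] in
/-- The trivial change of frame. [folklore] -/
theorem conj_one (ρ : FramedGaloisRep K (PadicAlgCl ℓ) n) : FramedRep.conj 1 ρ = ρ :=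
  ContinuousMonoidHom.ext fun g => by simp only [FramedRep.conj_apply, one_mul, inv_one, mul_one]

omit [NumberField K] in
/-- `det` is invariant under a change of frame. [folklore] -/
theorem det_conj_apply (P g : GL (Fin n) (PadicAlgCl ℓ)) :
    Matrix.GeneralLinearGroup.det (P * g * P⁻¹) = Matrix.GeneralLinearGroup.det g := by
  rw [map_mul, map_mul, map_inv]
  exact mul_inv_cancel_comm _ _

omit [NumberField K] in
/-- Twisting by a character preserves irreducibility (tree `Representation.isIrreducible_iff_of_forall_eq_units_smul`). [folklore] -/
theorem isIrreducible_twist {G : Type} [Group G] [TopologicalSpace G] [IsTopologicalGroup G] (ρ : FramedRep G (PadicAlgCl ℓ) n)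
    (χ : G →ₜ* (PadicAlgCl ℓ)ˣ) (h : ρ.IsIrreducible) : (FramedRep.twist ρ χ).IsIrreducible :=
  (Representation.isIrreducible_iff_of_forall_eq_units_smul (FramedRep.twist ρ χ).toRepresentation ρ.toRepresentation
    (fun g => χ g) fun g v => by
      rw [FramedRep.toRepresentation_apply_apply, FramedRep.toRepresentation_apply_apply, FramedRep.coe_twist_apply,
        Matrix.smul_mulVec]).2 h

omit [NumberField K] [NumberField L] in
/-- An irreducible restriction forces irreducibility (tree `Representation.isIrreducible_of_isIrreducible_comp`). [folklore] -/
theorem isIrreducible_of_restrictField (ρ : FramedGaloisRep K (PadicAlgCl ℓ) n) (h : (ρ.restrictField L).IsIrreducible) :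
    ρ.IsIrreducible :=
  Literature.RepresentationTheory.Semisimple.Representation.isIrreducible_of_isIrreducible_comp ρ.toRepresentation
    (absGaloisRestrict K L).toMonoidHom h


omit [NumberField K] [NumberField L] in
/-- **Restriction in a tower, up to an inner automorphism** (the two embeddings `Γ_{L'} → Γ_K` differ by conjugation: tree
`exists_absGaloisRestrict_absGaloisRestrict_eq_conj`, PROVED): `(ρ|Γ_L)|Γ_{L'} = ρ(τ)⁻¹ · ρ|Γ_{L'} · ρ(τ)` for one `τ ∈ Γ_K` serving all `ρ`. -/
theorem exists_restrictField_restrictField_eq_conj (L' : Type) [Field L'] [Algebra K L'] [Algebra L L'] [IsScalarTower K L L'] :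
    ∃ τ : Field.absoluteGaloisGroup K, ∀ ρ : FramedGaloisRep K (PadicAlgCl ℓ) n,
      (ρ.restrictField L).restrictField L' = FramedRep.conj (ρ τ)⁻¹ (ρ.restrictField L') := by
  obtain ⟨τ, hτ⟩ := exists_absGaloisRestrict_absGaloisRestrict_eq_conj K L L'
  refine ⟨τ, fun ρ => ContinuousMonoidHom.ext fun γ => ?_⟩
  simp only [FramedGaloisRep.restrictField_apply, FramedRep.conj_apply, hτ γ, map_mul, map_inv, inv_inv]

/-- **DIV rung, PROVED** (`ℓ ≠ 2`, `ℓ ∤ N`): from the tree's `exists_pow_norm_sub_one_lt_of_compactSpace` (a prime-to-`ℓ` power of `Ψ`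
lands in `U¹`) and `exists_continuousMonoidHom_pow_eq_of_norm_sub_one_lt` (`U¹` is uniquely `N·d`-divisible). [Serre, Local Fields XIV §4 Prop 10] -/
theorem div_rung (hℓ : ℓ ≠ 2) (Ψ : Field.absoluteGaloisGroup K →ₜ* (PadicAlgCl ℓ)ˣ) {N : ℕ} (hN : ¬ ℓ ∣ N) :
    ∃ (ψ : Field.absoluteGaloisGroup K →ₜ* (PadicAlgCl ℓ)ˣ) (m : ℕ), 0 < m ∧
      ∀ g : Field.absoluteGaloisGroup K, (ψ g ^ N * (Ψ g)⁻¹) ^ m = 1 := by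
  obtain ⟨d, hd, hdl, hΘ⟩ := exists_pow_norm_sub_one_lt_of_compactSpace hℓ Ψ
  have hNd : ¬ ℓ ∣ N * d := fun h => ((Fact.out : ℓ.Prime).dvd_mul.1 h).elim hN hdl
  have hχ : ∀ g, ‖(((Ψ ^ d) g : (PadicAlgCl ℓ)ˣ) : PadicAlgCl ℓ) - 1‖ < 1 := fun g => by
    rw [ContinuousMonoidHom.pow_apply, Units.val_pow_eq_pow_val]
    exact hΘ g
  obtain ⟨ξ, hξ, -⟩ := exists_continuousMonoidHom_pow_eq_of_norm_sub_one_lt hNd (Ψ ^ d) hχ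
  refine ⟨ξ, d, hd, fun g => ?_⟩
  rw [mul_pow, ← pow_mul, hξ g, ContinuousMonoidHom.pow_apply, inv_pow, mul_inv_cancel]

end Algebra

/-! ## §2 Relative avatars: invariance under `Γ_K`, change of frame, towers (0 sorry) -/
section RelAvatar

variable {K L : Type} [Field K] [NumberField K] [Field L] [NumberField L] [Algebra K L]
variable {ℓ : ℕ} [Fact ℓ.Prime] {n : ℕ}

omit [NumberField K] in
/-- Frobenius characteristic polynomials are invariant under change of frame (local copy of g25 / the tree's private
`hasFrobCharpolyAt_conj_iff_aux`). [folklore] -/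
theorem hasFrobCharpolyAt_conj_iff' {A : Type*} [CommRing A] [TopologicalSpace A] [IsTopologicalRing A]
    (v : HeightOneSpectrum (𝓞 K)) (Q : A[X]) (g : GL (Fin n) A) (r : FramedGaloisRep K A n) :
    FramedGaloisRep.HasFrobCharpolyAt v Q (FramedRep.conj g r) ↔ r.HasFrobCharpolyAt v Q := by
  refine forall₂_congr fun 𝔓 _ => forall₂_congr fun s _ => ?_
  have h : FramedRep.charpoly (FramedRep.conj g r) s = FramedRep.charpoly r s := by
    unfold FramedRep.charpoly
    rw [FramedRep.conj_apply, Units.val_mul, Units.val_mul, Matrix.coe_units_inv, Matrix.charpoly_units_conj]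
  rw [h]

variable {hK : isCompact_glFiniteIntegralLevel n K}

/-- Two relative avatars of `π` along `L/K` have the same Frobenius polynomials a.e. (g25, local copy). [folklore] -/
theorem frobenius_agree_of_relAvatar (π : AutomorphicRepData (AutomorphyDatum.gl n K hK)) (ι : PadicAlgCl ℓ ≃+* ℂ)
    (r r' : FramedGaloisRep L (PadicAlgCl ℓ) n)
    (h : (∀ᶠ w : HeightOneSpectrum (𝓞 L) in cofinite, ∀ (v : HeightOneSpectrum (𝓞 K)) (α : Multiset ℂ),
      w.asIdeal.under (𝓞 K) = v.asIdeal → π.HasSatakeParamAt v α →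
        r.IsUnramifiedAt w ∧ r.HasFrobCharpolyAt w (arithFrobPolyOfSatake ι w.residueCard 1 (α.map (fun a => a ^ w.asIdeal.inertiaDeg (𝓞 K)))))) (h' : (∀ᶠ w : HeightOneSpectrum (𝓞 L) in cofinite, ∀ (v : HeightOneSpectrum (𝓞 K)) (α : Multiset ℂ),
      w.asIdeal.under (𝓞 K) = v.asIdeal → π.HasSatakeParamAt v α →
        r'.IsUnramifiedAt w ∧ r'.HasFrobCharpolyAt w (arithFrobPolyOfSatake ι w.residueCard 1 (α.map (fun a => a ^ w.asIdeal.inertiaDeg (𝓞 K)))))) :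
    ∀ᶠ w : HeightOneSpectrum (𝓞 L) in cofinite, r.IsUnramifiedAt w ∧ r'.IsUnramifiedAt w ∧
      ∃ P : (PadicAlgCl ℓ)[X], r.HasFrobCharpolyAt w P ∧ r'.HasFrobCharpolyAt w P := by
  filter_upwards [h, h', eventually_under (F := K) (E := L) (AutomorphicRepData.hasSatakeParamAt_cofinite_holds π)] with w hw hw' hS
  obtain ⟨α, hα⟩ := hS (w.under (𝓞 K)) rfl
  obtain ⟨hur, hch⟩ := hw (w.under (𝓞 K)) α rfl hα
  obtain ⟨hur', hch'⟩ := hw' (w.under (𝓞 K)) α rfl hα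
  exact ⟨hur, hur', _, hch, hch'⟩

/-- **L1** (g25, local copy) — an a.e. compatible `ρ` over `K` restricts to a relative avatar of `π` along any layer. [folklore] -/
theorem relAvatar_restrictField_of_compatible (π : AutomorphicRepData (AutomorphyDatum.gl n K hK))
    (ι : PadicAlgCl ℓ ≃+* ℂ) (ρ : FramedGaloisRep K (PadicAlgCl ℓ) n)
    (hρ : ∀ᶠ v : HeightOneSpectrum (𝓞 K) in cofinite, SatakeFrobCompatibleAt ι π ρ v) :
    ∀ᶠ w : HeightOneSpectrum (𝓞 L) in cofinite, ∀ (v : HeightOneSpectrum (𝓞 K)) (α : Multiset ℂ),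
      w.asIdeal.under (𝓞 K) = v.asIdeal → π.HasSatakeParamAt v α →
        (ρ.restrictField L).IsUnramifiedAt w ∧ (ρ.restrictField L).HasFrobCharpolyAt w (arithFrobPolyOfSatake ι w.residueCard 1 (α.map (fun a => a ^ w.asIdeal.inertiaDeg (𝓞 K)))) := by
  filter_upwards [eventually_under (F := K) (E := L) hρ] with w hw v α hv hα
  obtain ⟨β, hβ, hur, hch⟩ := hw v hv
  obtain rfl := π.hasSatakeParamAt_unique_holds hβ hα
  exact hasFrobCharpolyAt_restrictField_arithFrobPolyOfSatake (L := L) ι ρ hv hur 1 hch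

/-- A relative avatar stays one under a change of frame. [folklore] -/
theorem relAvatar_conj (π : AutomorphicRepData (AutomorphyDatum.gl n K hK)) (ι : PadicAlgCl ℓ ≃+* ℂ)
    (r : FramedGaloisRep L (PadicAlgCl ℓ) n) (Q : GL (Fin n) (PadicAlgCl ℓ))
    (h : (∀ᶠ w : HeightOneSpectrum (𝓞 L) in cofinite, ∀ (v : HeightOneSpectrum (𝓞 K)) (α : Multiset ℂ),
      w.asIdeal.under (𝓞 K) = v.asIdeal → π.HasSatakeParamAt v α →
        r.IsUnramifiedAt w ∧ r.HasFrobCharpolyAt w (arithFrobPolyOfSatake ι w.residueCard 1 (α.map (fun a => a ^ w.asIdeal.inertiaDeg (𝓞 K)))))) :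
    ∀ᶠ w : HeightOneSpectrum (𝓞 L) in cofinite, ∀ (v : HeightOneSpectrum (𝓞 K)) (α : Multiset ℂ),
      w.asIdeal.under (𝓞 K) = v.asIdeal → π.HasSatakeParamAt v α →
        FramedGaloisRep.IsUnramifiedAt w (FramedRep.conj Q r) ∧ FramedGaloisRep.HasFrobCharpolyAt w (arithFrobPolyOfSatake ι w.residueCard 1 (α.map (fun a => a ^ w.asIdeal.inertiaDeg (𝓞 K)))) (FramedRep.conj Q r) :=
  h.mono fun w hw v α hv hα =>
    ⟨(FramedGaloisRep.isUnramifiedAt_conj_iff w Q r).2 (hw v α hv hα).1, (hasFrobCharpolyAt_conj_iff' w _ Q r).2 (hw v α hv hα).2⟩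

/-- **INVARIANCE.** The relative-avatar condition is `Gal(L/K)`-invariant (conjugate places lie over the same `v`, with the same
`f(w|v)` and `q_w`), so by Chebotarev + Brauer–Nesbitt over `L` (tree `FramedGaloisRep.nonempty_equiv_outerConj`, with the PROVED
`chebotarev_artinRep_holds`) every conjugate `r^τ`, `τ ∈ Γ_K`, is equivalent — hence conjugate by a matrix — to `r`. [folklore] -/
theorem relAvatar_invariant [IsGalois K L] (π : AutomorphicRepData (AutomorphyDatum.gl n K hK)) (ι : PadicAlgCl ℓ ≃+* ℂ)
    (r : FramedGaloisRep L (PadicAlgCl ℓ) n) (hr : r.toGaloisRep.IsSemisimple)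
    (hrel : (∀ᶠ w : HeightOneSpectrum (𝓞 L) in cofinite, ∀ (v : HeightOneSpectrum (𝓞 K)) (α : Multiset ℂ),
      w.asIdeal.under (𝓞 K) = v.asIdeal → π.HasSatakeParamAt v α →
        r.IsUnramifiedAt w ∧ r.HasFrobCharpolyAt w (arithFrobPolyOfSatake ι w.residueCard 1 (α.map (fun a => a ^ w.asIdeal.inertiaDeg (𝓞 K))))))
    (τ : Field.absoluteGaloisGroup K) :
    ∃ P : GL (Fin n) (PadicAlgCl ℓ), FramedRep.conj P (FramedGaloisRep.outerConj τ r) = r := by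
  haveI : FiniteDimensional K L := Module.Finite.of_restrictScalars_finite ℚ K L
  have hunr : ∀ᶠ w : HeightOneSpectrum (𝓞 L) in cofinite, r.IsUnramifiedAt w :=
    (frobenius_agree_of_relAvatar π ι r r hrel hrel).mono fun w hw => hw.1
  set g : L ≃ₐ[K] L := absGaloisQuot K L τ with hg
  have hinj : Function.Injective fun w : HeightOneSpectrum (𝓞 L) => g • w := MulAction.injective g
  have hrel' := hinj.tendsto_cofinite.eventually hrel
  have hstab : ∀ᶠ w : HeightOneSpectrum (𝓞 L) in cofinite, ∃ P : (PadicAlgCl ℓ)[X],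
      r.HasFrobCharpolyAt w P ∧ r.HasFrobCharpolyAt (absGaloisQuot K L τ • w) P := by
    filter_upwards [hrel, hrel', eventually_under (F := K) (E := L) (AutomorphicRepData.hasSatakeParamAt_cofinite_holds π)]
      with w hw hgw hS
    obtain ⟨α, hα⟩ := hS (w.under (𝓞 K)) rfl
    refine ⟨_, (hw (w.under (𝓞 K)) α rfl hα).2, ?_⟩
    have hu : (g • w).asIdeal.under (𝓞 K) = (w.under (𝓞 K)).asIdeal :=
      congrArg HeightOneSpectrum.asIdeal (HeightOneSpectrum.under_algEquiv_smul (σ := g) (w := w))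
    have h2 := (hgw (w.under (𝓞 K)) α hu hα).2
    rw [IsDedekindDomain.HeightOneSpectrum.residueCard_algEquiv_smul, HeightOneSpectrum.inertiaDeg_algEquiv_smul (σ := g) (w := w)] at h2
    rw [← hg]
    exact h2
  obtain ⟨e⟩ := FramedGaloisRep.nonempty_equiv_outerConj chebotarev_artinRep_holds r hr τ hunr hstab
  obtain ⟨P, hP⟩ := FramedRep.exists_eq_conj_of_equiv _ _ e
  exact ⟨P, hP.symm⟩

/-- **TOWER.** A relative avatar of `π` along `L/K` restricts to a relative avatar of `π` along `L'/K` for any further finite extension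
`L'/L` (`f(w'|v) = f(w'|w) f(w|v)`, `Frob_{w'} = Frob_w^{f(w'|w)}`: tree `hasFrobCharpolyAt_restrictField_arithFrobPolyOfSatake` over `L`,
Mathlib `Ideal.inertiaDeg_tower`). [folklore] -/
theorem relAvatar_tower (π : AutomorphicRepData (AutomorphyDatum.gl n K hK)) (ι : PadicAlgCl ℓ ≃+* ℂ)
    (r : FramedGaloisRep L (PadicAlgCl ℓ) n)
    (hrel : (∀ᶠ w : HeightOneSpectrum (𝓞 L) in cofinite, ∀ (v : HeightOneSpectrum (𝓞 K)) (α : Multiset ℂ),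
      w.asIdeal.under (𝓞 K) = v.asIdeal → π.HasSatakeParamAt v α →
        r.IsUnramifiedAt w ∧ r.HasFrobCharpolyAt w (arithFrobPolyOfSatake ι w.residueCard 1 (α.map (fun a => a ^ w.asIdeal.inertiaDeg (𝓞 K))))))
    (L' : Type) [Field L'] [NumberField L'] [Algebra K L'] [Algebra L L'] [IsScalarTower K L L'] :
    ∀ᶠ w' : HeightOneSpectrum (𝓞 L') in cofinite, ∀ (v : HeightOneSpectrum (𝓞 K)) (α : Multiset ℂ),
      w'.asIdeal.under (𝓞 K) = v.asIdeal → π.HasSatakeParamAt v α →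
        (r.restrictField L').IsUnramifiedAt w' ∧ (r.restrictField L').HasFrobCharpolyAt w' (arithFrobPolyOfSatake ι w'.residueCard 1 (α.map (fun a => a ^ w'.asIdeal.inertiaDeg (𝓞 K)))) := by
  haveI : IsScalarTower (𝓞 K) (𝓞 L) (𝓞 L') :=
    IsScalarTower.of_algebraMap_eq fun x ↦ Subtype.ext (IsScalarTower.algebraMap_apply K L L' (x : K))
  filter_upwards [eventually_under (F := L) (E := L') hrel] with w' hw' v α hv hα
  have hwv : (w'.under (𝓞 L)).asIdeal.under (𝓞 K) = v.asIdeal := by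
    rw [show (w'.under (𝓞 L)).asIdeal = w'.asIdeal.under (𝓞 L) from rfl, Ideal.under_under]
    exact hv
  obtain ⟨hur, hch⟩ := hw' (w'.under (𝓞 L)) rfl v α hwv hα
  have key := hasFrobCharpolyAt_restrictField_arithFrobPolyOfSatake (K := L) (L := L') ι r (v := w'.under (𝓞 L)) (w := w') rfl hur 1 hch
  haveI : w'.asIdeal.LiesOver (w'.under (𝓞 L)).asIdeal := ⟨rfl⟩
  have hM : (α.map (fun a => a ^ (w'.under (𝓞 L)).asIdeal.inertiaDeg (𝓞 K))).map (fun a => a ^ w'.asIdeal.inertiaDeg (𝓞 L)) =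
      α.map (fun a => a ^ w'.asIdeal.inertiaDeg (𝓞 K)) := by
    rw [Multiset.map_map]
    refine Multiset.map_congr rfl fun a _ => ?_
    rw [Function.comp_apply, ← pow_mul, ← Ideal.inertiaDeg_tower]
  rw [hM] at key
  exact key

end RelAvatar

end Summit.Langlands.Langlands.Theorems.TatePhantomLift
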